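import Mathlib.Analysis.Matrix.HermitianFunctionalCalculus
import Mathlib.Data.Real.Sign

/-!
# Stub K2 `stub_gappedSignPerturbation` of line `determinant-tilt` (crux `SpectralDefectExtinction.ExtinctionBuildsQCD`,
# item stmt-QuantumFields-18064) — the gapped sign-perturbation lemma

For Hermitian matrices `A, B` over `ℂ` on a finite index type whose spectra both avoid `(−g, g)` (`g > 0`):
`‖sgn A − sgn B‖_F² ≤ ‖A − B‖_F² / g²`, Frobenius norms written as double sums of squared entry norms and
`sgn = cfc Real.sign` (Mathlib's continuous functional calculus on `Matrix n n ℂ`, `Matrix.IsHermitian.cfc_eq`).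

Proof (pure finite-dimensional algebra, no resolvents): let `U, W` be eigenvector unitaries of `A, B` with eigenvalues
`α, β` and put `M = U⋆ W`.  For every real `f`, `U⋆ (f(A) − f(B)) W = diag(f∘α) M − M diag(f∘β)` has entries
`(f αᵢ − f βⱼ) Mᵢⱼ` (§2), and the double sum of squared entry norms is invariant under `X ↦ U⋆ X W` (§1, via
`Σᵢⱼ ‖Xᵢⱼ‖² = re tr (X⋆ X)` and cyclicity of the trace).  Hence any entrywise bound
`(f αᵢ − f βⱼ)² ≤ c (αᵢ − βⱼ)²` integrates to `‖f(A) − f(B)‖_F² ≤ c ‖A − B‖_F²` (§2, `sum_norm_sq_cfc_sub_le`); for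
`f = sign` and levels of modulus `≥ g` the entrywise bound holds with `c = 1/g²` (§2, `sign_sub_sign_sq_le`: either the
signs agree, or `|αᵢ − βⱼ| = |αᵢ| + |βⱼ| ≥ 2g = g · |sign αᵢ − sign βⱼ|`).
References (prose): Bhatia, Matrix Analysis, §VII.5 (perturbation of spectral functions in the Frobenius norm);
Horn–Johnson, Matrix Analysis (2013), Thm 2.2.2 (unitary invariance of the Frobenius norm).
-/

noncomputable section

namespace Summit.QuantumFields.QCD.Cruxes.ExtinctionBuildsQCD.DeterminantTilt

open scoped BigOperators Matrix
open Matrix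

section GappedSign

open Finset

variable {ι : Type*} [Fintype ι]

/-! ## §1 The squared Frobenius norm as a trace, and its unitary invariance -/

/-- `Σᵢⱼ ‖Mᵢⱼ‖² = re tr (M⋆ M)` (adapted from `Literature…YangMillsClassical.frobenius_norm_sq_eq_re_trace`,
without the norm instance). -/
private theorem sum_norm_sq_eq_re_trace (M : Matrix ι ι ℂ) :
    ∑ i, ∑ j, ‖M i j‖ ^ 2 = (Matrix.trace (star M * M)).re := by
  rw [Finset.sum_comm]
  simp only [Matrix.trace, Matrix.diag, Matrix.mul_apply, Matrix.star_apply, RCLike.star_def,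
    Complex.conj_mul', Complex.re_sum]
  norm_cast

/-- Unitary invariance of the squared Frobenius norm: `Σᵢⱼ ‖(U⋆ M W)ᵢⱼ‖² = Σᵢⱼ ‖Mᵢⱼ‖²` when `U U⋆ = 1 = W W⋆`
(adapted from `Literature…YangMillsClassical.frobenius_norm_unitaryGroup_mul`). -/
private theorem sum_norm_sq_conj_eq [DecidableEq ι] (U W M : Matrix ι ι ℂ) (hU : U * star U = 1)
    (hW : W * star W = 1) :
    ∑ i, ∑ j, ‖(star U * M * W) i j‖ ^ 2 = ∑ i, ∑ j, ‖M i j‖ ^ 2 := by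
  have h : star (star U * M * W) * (star U * M * W) = star W * (star M * M) * W := by
    rw [star_mul, star_mul, star_star]
    simp only [Matrix.mul_assoc]
    rw [← Matrix.mul_assoc U (star U), hU, Matrix.one_mul]
  rw [sum_norm_sq_eq_re_trace, sum_norm_sq_eq_re_trace, h, trace_mul_cycle, hW, Matrix.one_mul]

/-! ## §2 Spectral functions in the two eigenbases -/

variable [DecidableEq ι]

/-- In the eigenbasis of a Hermitian `A` (`f(A) = U diag(f∘α) U⋆`, `Matrix.IsHermitian.cfc_eq`):
`U⋆ f(A) W = diag(f∘α) (U⋆ W)`. -/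
private theorem star_mul_cfc_mul {A : Matrix ι ι ℂ} (hA : A.IsHermitian) (f : ℝ → ℝ) (W : Matrix ι ι ℂ) :
    star (hA.eigenvectorUnitary : Matrix ι ι ℂ) * cfc f A * W =
      diagonal (RCLike.ofReal ∘ f ∘ hA.eigenvalues) * (star (hA.eigenvectorUnitary : Matrix ι ι ℂ) * W) := by
  rw [hA.cfc_eq, Matrix.IsHermitian.cfc, Unitary.conjStarAlgAut_apply, ← Matrix.mul_assoc,
    ← Matrix.mul_assoc, Unitary.coe_star_mul_self, Matrix.one_mul, Matrix.mul_assoc]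

/-- In the eigenbasis of a Hermitian `B`, `W` its eigenvector unitary: `V f(B) W = (V W) diag(f∘β)`. -/
private theorem mul_cfc_mul_eigenvectorUnitary {B : Matrix ι ι ℂ} (hB : B.IsHermitian) (f : ℝ → ℝ)
    (V : Matrix ι ι ℂ) :
    V * cfc f B * (hB.eigenvectorUnitary : Matrix ι ι ℂ) =
      V * (hB.eigenvectorUnitary : Matrix ι ι ℂ) * diagonal (RCLike.ofReal ∘ f ∘ hB.eigenvalues) := by
  rw [hB.cfc_eq, Matrix.IsHermitian.cfc, Unitary.conjStarAlgAut_apply]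
  simp only [Matrix.mul_assoc]
  rw [Unitary.coe_star_mul_self, Matrix.mul_one]

/-- The `(i, j)` entry of `U⋆ (f(A) − f(B)) W` has squared norm `(f αᵢ − f βⱼ)² ‖(U⋆ W)ᵢⱼ‖²`. -/
private theorem norm_sq_conj_cfc_sub_apply {A B : Matrix ι ι ℂ} (hA : A.IsHermitian) (hB : B.IsHermitian)
    (f : ℝ → ℝ) (i j : ι) :
    ‖(star (hA.eigenvectorUnitary : Matrix ι ι ℂ) * (cfc f A - cfc f B) * (hB.eigenvectorUnitary : Matrix ι ι ℂ)) i j‖ ^ 2 =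
      (f (hA.eigenvalues i) - f (hB.eigenvalues j)) ^ 2 *
        ‖(star (hA.eigenvectorUnitary : Matrix ι ι ℂ) * (hB.eigenvectorUnitary : Matrix ι ι ℂ)) i j‖ ^ 2 := by
  rw [Matrix.mul_sub, Matrix.sub_mul, star_mul_cfc_mul hA f, mul_cfc_mul_eigenvectorUnitary hB f, Matrix.sub_apply,
    diagonal_mul, mul_diagonal, Function.comp_apply, Function.comp_apply, Function.comp_apply, Function.comp_apply,
    mul_comm ((star (hA.eigenvectorUnitary : Matrix ι ι ℂ) * (hB.eigenvectorUnitary : Matrix ι ι ℂ)) i j), ← sub_mul,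
    norm_mul, ← RCLike.ofReal_sub, RCLike.norm_ofReal, mul_pow, sq_abs]

/-- **Frobenius perturbation of spectral functions.** If `(f αᵢ − f βⱼ)² ≤ c (αᵢ − βⱼ)²` for all pairs of eigenvalues
of the Hermitian `A, B`, then `Σᵢⱼ ‖(f(A) − f(B))ᵢⱼ‖² ≤ c Σᵢⱼ ‖(A − B)ᵢⱼ‖²`. -/
private theorem sum_norm_sq_cfc_sub_le {A B : Matrix ι ι ℂ} (hA : A.IsHermitian) (hB : B.IsHermitian) (f : ℝ → ℝ)
    {c : ℝ} (h : ∀ i j, (f (hA.eigenvalues i) - f (hB.eigenvalues j)) ^ 2 ≤ c * (hA.eigenvalues i - hB.eigenvalues j) ^ 2) :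
    ∑ i, ∑ j, ‖(cfc f A - cfc f B) i j‖ ^ 2 ≤ c * ∑ i, ∑ j, ‖(A - B) i j‖ ^ 2 := by
  have hU : (hA.eigenvectorUnitary : Matrix ι ι ℂ) * star (hA.eigenvectorUnitary : Matrix ι ι ℂ) = 1 :=
    Unitary.mul_star_self_of_mem hA.eigenvectorUnitary.prop
  have hW : (hB.eigenvectorUnitary : Matrix ι ι ℂ) * star (hB.eigenvectorUnitary : Matrix ι ι ℂ) = 1 :=
    Unitary.mul_star_self_of_mem hB.eigenvectorUnitary.prop
  have hid : A - B = cfc (id : ℝ → ℝ) A - cfc (id : ℝ → ℝ) B := by rw [cfc_id ℝ A hA.isSelfAdjoint, cfc_id ℝ B hB.isSelfAdjoint]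
  calc ∑ i, ∑ j, ‖(cfc f A - cfc f B) i j‖ ^ 2
      = ∑ i, ∑ j, ‖(star (hA.eigenvectorUnitary : Matrix ι ι ℂ) * (cfc f A - cfc f B) *
          (hB.eigenvectorUnitary : Matrix ι ι ℂ)) i j‖ ^ 2 := (sum_norm_sq_conj_eq _ _ _ hU hW).symm
    _ = ∑ i, ∑ j, (f (hA.eigenvalues i) - f (hB.eigenvalues j)) ^ 2 *
          ‖(star (hA.eigenvectorUnitary : Matrix ι ι ℂ) * (hB.eigenvectorUnitary : Matrix ι ι ℂ)) i j‖ ^ 2 := by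
        simp only [norm_sq_conj_cfc_sub_apply hA hB]
    _ ≤ ∑ i, ∑ j, c * (hA.eigenvalues i - hB.eigenvalues j) ^ 2 *
          ‖(star (hA.eigenvectorUnitary : Matrix ι ι ℂ) * (hB.eigenvectorUnitary : Matrix ι ι ℂ)) i j‖ ^ 2 :=
        sum_le_sum fun i _ => sum_le_sum fun j _ => mul_le_mul_of_nonneg_right (h i j) (sq_nonneg _)
    _ = c * ∑ i, ∑ j, ‖(star (hA.eigenvectorUnitary : Matrix ι ι ℂ) * (cfc (id : ℝ → ℝ) A - cfc (id : ℝ → ℝ) B) *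
          (hB.eigenvectorUnitary : Matrix ι ι ℂ)) i j‖ ^ 2 := by
        rw [mul_sum]
        refine sum_congr rfl fun i _ => ?_
        rw [mul_sum]
        refine sum_congr rfl fun j _ => ?_
        rw [norm_sq_conj_cfc_sub_apply hA hB, mul_assoc]
        rfl
    _ = c * ∑ i, ∑ j, ‖(A - B) i j‖ ^ 2 := by rw [← hid, sum_norm_sq_conj_eq _ _ _ hU hW]

/-- **The scalar inequality behind the gapped sign-perturbation lemma**: for reals `a, b` of modulus `≥ g > 0`,
`(sign a − sign b)² ≤ (a − b)²/g²` (the signs agree, or `|a − b| = |a| + |b| ≥ 2g`). -/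
private theorem sign_sub_sign_sq_le {a b g : ℝ} (hg : 0 < g) (ha : g ≤ |a|) (hb : g ≤ |b|) :
    (Real.sign a - Real.sign b) ^ 2 ≤ (1 / g) ^ 2 * (a - b) ^ 2 := by
  have key : ∀ x : ℝ, g ≤ |x| → (g ≤ x ∧ Real.sign x = 1) ∨ (g ≤ -x ∧ Real.sign x = -1) := fun x hx => by
    rcases lt_trichotomy x 0 with h | h | h
    · exact Or.inr ⟨by rwa [abs_of_neg h] at hx, Real.sign_of_neg h⟩
    · rw [h, abs_zero] at hx
      exact absurd hx (not_le.2 hg)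
    · exact Or.inl ⟨by rwa [abs_of_pos h] at hx, Real.sign_of_pos h⟩
  rw [div_pow, one_pow, one_div, inv_mul_eq_div, le_div_iff₀ (by positivity)]
  rcases key a ha with ⟨ha0, hsa⟩ | ⟨ha0, hsa⟩ <;> rcases key b hb with ⟨hb0, hsb⟩ | ⟨hb0, hsb⟩ <;> rw [hsa, hsb] <;>
    nlinarith

end GappedSign

/-! ## §3 The registered stub -/

/-- **Stub K2 (`stub_gappedSignPerturbation`) — THE GAPPED SIGN-PERTURBATION LEMMA (ABSTRACT, DETERMINISTIC).** For
Hermitian `A, B` on a finite index type whose spectra both avoid `(−g, g)` (`g > 0`): `‖sgn A − sgn B‖_F ≤ ‖A − B‖_F / g`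
(Frobenius norms, written as sums of squared entry norms; `sgn = cfc Real.sign`). Proof (no integrals, no resolvents):
with `U, W` eigenvector unitaries of `A, B` (eigenvalues `α, β`) and `M = U⋆ W`, one has
`U⋆ (sgn A − sgn B) W = diag(sign α) M − M diag(sign β)` and `U⋆ (A − B) W = diag(α) M − M diag(β)`
(`Matrix.IsHermitian.cfc_eq`), with entries `(sign αᵢ − sign βⱼ) Mᵢⱼ` and `(αᵢ − βⱼ) Mᵢⱼ`; entrywise
`|sign αᵢ − sign βⱼ| ≤ |αᵢ − βⱼ|/g` (the signs agree, or `|αᵢ − βⱼ| = |αᵢ| + |βⱼ| ≥ 2g`); and `Σᵢⱼ ‖Xᵢⱼ‖² = re tr (X⋆X)` is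
invariant under `X ↦ U⋆ X W`.  (Equivalently: `X = sgn A − sgn B` solves the Sylvester equation
`|A|X + X|B| = (A−B) − sgn A (A−B) sgn B`, read in the two eigenbases.)  USE (K, stage 3/5): with `B = E` block-diagonal
over well clusters and `A = E + T`, the inter-cluster blocks of `sgn(E+T)` are bounded by `‖T‖_F/g`, `g` the smaller of the
two spectral gaps at `0` — a RESONANCE needs a cluster level within `≍ ‖T‖` of zero. (Bhatia, Matrix Analysis, VII.5;
Horn–Johnson, Matrix Analysis, Thm 2.2.2.) -/
theorem stub_gappedSignPerturbation :
    (∀ (n : Type) [Fintype n] [DecidableEq n] (A B : Matrix n n ℂ) (hA : A.IsHermitian) (hB : B.IsHermitian) (g : ℝ),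
      0 < g → (∀ i, g ≤ |hA.eigenvalues i|) → (∀ i, g ≤ |hB.eigenvalues i|) →
      ∑ i, ∑ j, ‖(cfc Real.sign A - cfc Real.sign B) i j‖ ^ 2 ≤ (1 / g) ^ 2 * ∑ i, ∑ j, ‖(A - B) i j‖ ^ 2) := by
  intro n _ _ A B hA hB g hg hAg hBg
  exact sum_norm_sq_cfc_sub_le hA hB Real.sign fun i j => sign_sub_sign_sq_le hg (hAg i) (hBg j)

end Summit.QuantumFields.QCD.Cruxes.ExtinctionBuildsQCD.DeterminantTilt

end
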